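import Literature.RingTheory.MvPowerSeries.AdicTaylor
import Mathlib.RingTheory.MvPowerSeries.Order
import Mathlib.Data.Nat.Choose.Lucas
import Mathlib.Algebra.CharP.Basic
import Mathlib.Data.Finsupp.Lex
import HarnessLib

/-!
# Divided (Hasse) derivatives of power series: ORDER bounds, and Lucas selection of the surviving monomials

Topic: `Literature/RingTheory/MvPowerSeries`. For the divided partial derivatives `Δ_α = hasseDeriv α` of `A⟦X_σ⟧`
(`AdicTaylor.lean`: `coeff β (Δ_α f) = C(α+β, α) · f_{α+β}`, Bourbaki's formula (21)) this file proves: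

* `order_le_order_hasseDeriv_add_degree` — **`ord f ≤ ord (Δ_α f) + |α|`**: a divided derivative of multi-order `α`
  lowers the order (`MvPowerSeries.order`, total degree) by at most `|α| = α.degree` (immediate from (21): the
  coefficient of `X^β` in `Δ_α f` is a multiple of `f_{α+β}`);
* `hasseDeriv_monomial_add'`, `hasseDeriv_monomial_of_not_le'`, `hasseDeriv_monomial_self'` — the values on monomials
  in the ADDITIVE indexing `Δ_α (a X^{α+β}) = C(α+β, α) a X^β` used by order computations (the subtractive form
  `Δ_α (c X^θ) = C(θ, α) c X^{θ−α}` is `hasseDeriv_monomial` of `HasseDerivFrobenius.lean`; primes avoid the name);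
* `order_monomial_one_mul` — `ord (X^θ · f) = ord f + |θ|`; `le_order_finsetSum` — a common lower bound of the orders of
  the summands bounds the order of a finite sum (order of formal power series, Zariski–Samuel II Ch. VII §1);
* (characteristic `p`, LUCAS SELECTION) `Nat.le_of_not_dvd_choose_add_pow_mul`, `Nat.le_and_le_of_not_dvd_choose` —
  digit consequences of Lucas' congruence (Mathlib `Choose.choose_modEq_choose_mod_mul_choose_div_nat`): if
  `p ∤ C(a + p·b + p^e·c, α + p·β)` with digits `a, α < p`, `b, β < p^{e−1}`, then `α ≤ a` and `β ≤ b`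
  (N. J. Fine 1947, Thm 2: `p ∤ C(N, k)` iff every base-`p` digit of `k` is `≤` that of `N`); and its power-series
  form `le_of_hasseDeriv_monomial_ne_zero`: in a ring of characteristic `p`, if `Δ_{α + p•β} (a·X^{a' + p•b' + p^e•c}) ≠ 0`
  (digit bounds as above) then `α ≤ a'` and `β ≤ b'` componentwise.

These are the generic lemmas repeatedly re-derived in the kernel-evidence files of the res-hironaka campaign (GAP-LEDGER
rows R05/R40, §9 of [Hironaka2017]: orders of `∂^{(α+pβ)}ϵ · ∂^{(qγ)}ϵ` in `K⟦x⟧`); nothing here refers to that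
manuscript, and nothing from it is asserted.

## References
* N. Bourbaki, *Algèbre commutative*, Ch. III §4 no. 5, formula (21) [Bourbaki1989CommAlg] — definition/coefficients of `Δ_α`.
* N. J. Fine, *Binomial coefficients modulo a prime*, Amer. Math. Monthly 54 (1947) 589–592, Theorems 1–2 [Fine1947].
* O. Zariski, P. Samuel, *Commutative Algebra II*, Ch. VII §1 (order of formal power series) [ZariskiSamuel1960].
-/

noncomputable section

open _root_.MvPowerSeries Finsupp

namespace Literature.RingTheory.MvPowerSeries

universe u v

/-! ## Values on monomials, additive indexing -/

section Monomials

variable {σ : Type v} {A : Type u} [CommRing A]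

/-- `Δ_α (a·X^{α+β}) = C(α+β, α)·a·X^β` (multi-index binomial written as in `coeff_hasseDeriv`).
[cite: Bourbaki1989CommAlg, Ch. III §4 no. 5 (21)] -/
theorem hasseDeriv_monomial_add' (α β : σ →₀ ℕ) (a : A) :
    hasseDeriv α (monomial (α + β) a) =
      monomial β ((((α + β).prod fun s k => k.choose (α s) : ℕ) : A) * a) := by
  classical
  ext δ
  rw [coeff_hasseDeriv, coeff_monomial, coeff_monomial]
  by_cases h : δ = β
  · subst h; simp
  · have h' : ¬ α + δ = α + β := fun e => h (add_left_cancel e)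
    rw [if_neg h', if_neg h, mul_zero]

/-- `Δ_α (a·X^m) = 0` unless `α ≤ m`. [cite: Bourbaki1989CommAlg, Ch. III §4 no. 5 (21)] -/
theorem hasseDeriv_monomial_of_not_le' {α m : σ →₀ ℕ} (h : ¬ α ≤ m) (a : A) :
    hasseDeriv α (monomial m a) = 0 := by
  classical
  ext δ
  rw [coeff_hasseDeriv, coeff_monomial, map_zero]
  have h' : ¬ α + δ = m := fun e => h (e ▸ le_self_add)
  rw [if_neg h', mul_zero]

/-- `Δ_α (a·X^α) = a` (the constant series `monomial 0 a`). [cite: Bourbaki1989CommAlg, Ch. III §4 no. 5 (21)] -/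
theorem hasseDeriv_monomial_self' (α : σ →₀ ℕ) (a : A) :
    hasseDeriv α (monomial α a) = monomial 0 a := by
  have h := hasseDeriv_monomial_add' α 0 a
  rw [add_zero] at h
  rw [h]
  congr 1
  have : (α.prod fun s k => k.choose (α s)) = 1 := by
    rw [Finsupp.prod]
    exact Finset.prod_eq_one fun s _ => Nat.choose_self _
  rw [this, Nat.cast_one, one_mul]

end Monomials

/-! ## Order bounds -/

section Order

variable {σ : Type v} {A : Type u} [CommRing A]

/-- **ORDER BOUND FOR DIVIDED DERIVATIVES: `ord f ≤ ord (Δ_α f) + |α|`.** Since the coefficient of `X^β` in `Δ_α f`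
is `C(α+β, α) · f_{α+β}`, every coefficient of `Δ_α f` in degree `< ord f − |α|` vanishes.
[cite: Bourbaki1989CommAlg, Ch. III §4 no. 5 (21)] -/
theorem order_le_order_hasseDeriv_add_degree (α : σ →₀ ℕ) (f : MvPowerSeries σ A) :
    f.order ≤ (hasseDeriv α f).order + (α.degree : ℕ∞) := by
  have key : f.order - (α.degree : ℕ∞) ≤ (hasseDeriv α f).order := by
    refine MvPowerSeries.le_order fun d hd => ?_
    rw [coeff_hasseDeriv]
    have hlt : ((α + d).degree : ℕ∞) < f.order := by
      rw [map_add, Nat.cast_add, add_comm]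
      exact lt_tsub_iff_right.mp hd
    rw [coeff_of_lt_order hlt, mul_zero]
  calc f.order ≤ f.order - (α.degree : ℕ∞) + (α.degree : ℕ∞) := le_tsub_add
    _ ≤ (hasseDeriv α f).order + (α.degree : ℕ∞) := add_le_add key le_rfl

/-- `ord (X^θ · f) = ord f + |θ|` (order of formal power series: `o(fg) ≥ o(f) + o(g)` with equality for a monomial
factor). [cite: ZariskiSamuel1960, Ch. VII §1] -/
theorem order_monomial_one_mul (θ : σ →₀ ℕ) (f : MvPowerSeries σ A) :
    (monomial θ (1 : A) * f).order = f.order + (θ.degree : ℕ∞) := by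
  classical
  apply le_antisymm
  · by_cases hf : f = 0
    · subst hf; simp
    obtain ⟨d, hd, hdeg⟩ :=
      exists_coeff_ne_zero_and_order ((ne_zero_iff_order_finite (f := f)).mp hf)
    have hc : coeff (d + θ) (monomial θ (1 : A) * f) ≠ 0 := by
      rw [coeff_monomial_mul, if_pos le_add_self, one_mul, add_tsub_cancel_right]
      exact hd
    calc (monomial θ (1 : A) * f).order ≤ ((d + θ).degree : ℕ∞) := order_le hc
      _ = f.order + (θ.degree : ℕ∞) := by rw [map_add, Nat.cast_add, hdeg]
  · refine MvPowerSeries.le_order fun d hd => ?_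
    rw [coeff_monomial_mul]
    split_ifs with h
    · rw [one_mul]
      apply coeff_of_lt_order
      have : ((d - θ).degree : ℕ∞) + (θ.degree : ℕ∞) = (d.degree : ℕ∞) := by
        rw [← Nat.cast_add, ← map_add, tsub_add_cancel_of_le h]
      rw [← this] at hd
      exact lt_of_add_lt_add_right hd
    · rfl

/-- A common lower bound of the orders of the summands bounds the order of a finite sum (`o(f + g) ≥ min(o(f), o(g))`,
iterated). [cite: ZariskiSamuel1960, Ch. VII §1] -/
theorem le_order_finsetSum {ι : Type*} (s : Finset ι) (f : ι → MvPowerSeries σ A) (m : ℕ∞)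
    (h : ∀ i ∈ s, m ≤ (f i).order) : m ≤ (∑ i ∈ s, f i).order := by
  classical
  induction s using Finset.induction_on with
  | empty => simp
  | insert i s hi ih =>
    rw [Finset.sum_insert hi]
    exact (le_min (h i (Finset.mem_insert_self i s)) (ih fun j hj => h j (Finset.mem_insert_of_mem hj))).trans
      min_order_le_add

end Order

/-! ## Lucas selection (characteristic `p`) -/

section Lucas

variable {p : ℕ} [hp : Fact p.Prime]

/-- One Lucas step in divisibility form: `p ∤ C(m,k) ⇒ p ∤ C(m mod p, k mod p)` and `p ∤ C(m/p, k/p)`.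
[cite: Fine1947, Thm 1] -/
theorem _root_.Nat.not_dvd_choose_mod_and_div_of_not_dvd_choose {m k : ℕ} (h : ¬ p ∣ m.choose k) :
    ¬ p ∣ (m % p).choose (k % p) ∧ ¬ p ∣ (m / p).choose (k / p) := by
  have hmod := Choose.choose_modEq_choose_mod_mul_choose_div_nat (n := m) (k := k) (p := p)
  refine ⟨fun hd => h ?_, fun hd => h ?_⟩
  · exact (hmod.dvd_iff dvd_rfl).mpr (dvd_mul_of_dvd_left hd _)
  · exact (hmod.dvd_iff dvd_rfl).mpr (dvd_mul_of_dvd_right hd _)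

omit hp in
/-- `p ∤ C(a, α)` forces `α ≤ a` (since `C(a, α) = 0` for `α > a`; the one-digit case of Fine's criterion).
[cite: Fine1947, Thm 2] -/
theorem _root_.Nat.le_of_not_dvd_choose {a α : ℕ} (h : ¬ p ∣ a.choose α) : α ≤ a := by
  by_contra hlt
  exact h (by rw [Nat.choose_eq_zero_of_lt (not_le.mp hlt)]; exact dvd_zero p)

/-- **Digit lemma** (Fine): for `β, b < p^s` and any `c`, `p ∤ C(b + p^s·c, β)` forces `β ≤ b` — the base-`p` digits
of `β` are bounded by those of `b`, the summand `p^s·c` living in higher digits. [cite: Fine1947, Thm 2] -/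
theorem _root_.Nat.le_of_not_dvd_choose_add_pow_mul (s : ℕ) :
    ∀ {b β c : ℕ}, β < p ^ s → b < p ^ s → ¬ p ∣ (b + p ^ s * c).choose β → β ≤ b := by
  induction s with
  | zero =>
    intro b β c hβ _ _
    have : β = 0 := by simpa using hβ
    omega
  | succ s ih =>
    intro b β c hβ hb h
    have hp0 : 0 < p := hp.out.pos
    obtain ⟨h1, h2⟩ := Nat.not_dvd_choose_mod_and_div_of_not_dvd_choose h
    have e1 : (b + p ^ (s + 1) * c) % p = b % p := by
      rw [pow_succ', mul_assoc, Nat.add_mul_mod_self_left]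
    rw [e1] at h1
    have hlow : β % p ≤ b % p := Nat.le_of_not_dvd_choose h1
    have e2 : (b + p ^ (s + 1) * c) / p = b / p + p ^ s * c := by
      rw [pow_succ', mul_assoc, Nat.add_mul_div_left _ _ hp0]
    rw [e2] at h2
    have hβ' : β / p < p ^ s := by
      rw [Nat.div_lt_iff_lt_mul hp0]; rw [pow_succ] at hβ; exact hβ
    have hb' : b / p < p ^ s := by
      rw [Nat.div_lt_iff_lt_mul hp0]; rw [pow_succ] at hb; exact hb
    have hhigh : β / p ≤ b / p := ih hβ' hb' h2
    calc β = p * (β / p) + β % p := (Nat.div_add_mod β p).symm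
      _ ≤ p * (b / p) + b % p := add_le_add (Nat.mul_le_mul_left _ hhigh) hlow
      _ = b := Nat.div_add_mod b p

/-- **Pair-digit lemma**: with `a, α < p`, `b, β < p^{e−1}`, `0 < e`: `p ∤ C(a + p·b + p^e·c, α + p·β)` forces `α ≤ a`
and `β ≤ b`. [cite: Fine1947, Thm 2] -/
theorem _root_.Nat.le_and_le_of_not_dvd_choose {e a b c α β : ℕ} (he : 0 < e) (ha : a < p) (hα : α < p)
    (hb : b < p ^ (e - 1)) (hβ : β < p ^ (e - 1))
    (h : ¬ p ∣ (a + p * b + p ^ e * c).choose (α + p * β)) : α ≤ a ∧ β ≤ b := by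
  have hp0 : 0 < p := hp.out.pos
  obtain ⟨h1, h2⟩ := Nat.not_dvd_choose_mod_and_div_of_not_dvd_choose h
  have epe : p ^ e = p * p ^ (e - 1) := by
    rw [← pow_succ']; congr 1; omega
  have e1 : (a + p * b + p ^ e * c) % p = a := by
    rw [epe, mul_assoc, add_assoc, ← mul_add, Nat.add_mul_mod_self_left, Nat.mod_eq_of_lt ha]
  have e1' : (α + p * β) % p = α := by rw [Nat.add_mul_mod_self_left, Nat.mod_eq_of_lt hα]
  have e2 : (a + p * b + p ^ e * c) / p = b + p ^ (e - 1) * c := by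
    rw [epe, mul_assoc, add_assoc, ← mul_add, Nat.add_mul_div_left _ _ hp0, Nat.div_eq_of_lt ha, zero_add]
  have e2' : (α + p * β) / p = β := by rw [Nat.add_mul_div_left _ _ hp0, Nat.div_eq_of_lt hα, zero_add]
  rw [e1, e1'] at h1
  rw [e2, e2'] at h2
  exact ⟨Nat.le_of_not_dvd_choose h1, Nat.le_of_not_dvd_choose_add_pow_mul (e - 1) hβ hb h2⟩

variable {σ : Type v} {A : Type u} [CommRing A] [CharP A p]

/-- **LUCAS SELECTION for divided derivatives.** In a ring of characteristic `p`: if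
`Δ_{α + p•β} (a·X^{a' + p•b' + p^e•c}) ≠ 0` with digit bounds `a'_i, α_i < p`, `b'_i, β_i < p^{e−1}` (`0 < e`), then
`α ≤ a'` and `β ≤ b'` componentwise. (The surviving monomials of `Δ_{α+pβ}` are exactly those whose mixed-radix
digit pair dominates `(α, β)` digitwise.) [cite: Fine1947, Thm 2] -/
theorem le_of_hasseDeriv_monomial_ne_zero [Fintype σ] {e : ℕ} (he : 0 < e) {a' b' c α β : σ →₀ ℕ}
    (ha : ∀ i, a' i < p) (hα : ∀ i, α i < p) (hb : ∀ i, b' i < p ^ (e - 1)) (hβ : ∀ i, β i < p ^ (e - 1))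
    (coef : A) (h : hasseDeriv (α + p • β) (monomial (a' + p • b' + p ^ e • c) coef) ≠ 0) :
    α ≤ a' ∧ β ≤ b' := by
  classical
  by_cases hle : α + p • β ≤ a' + p • b' + p ^ e • c
  · obtain ⟨d, hd⟩ := exists_add_of_le hle
    rw [hd, hasseDeriv_monomial_add'] at h
    have hC : ¬ p ∣ ((α + p • β + d).prod fun s k => k.choose ((α + p • β) s)) := by
      intro hdvd; apply h
      rw [(CharP.cast_eq_zero_iff A p _).mpr hdvd, zero_mul, map_zero]
    rw [prod_choose_eq] at hC
    have hi : ∀ i, α i ≤ a' i ∧ β i ≤ b' i := by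
      intro i
      have hndvd : ¬ p ∣ ((α + p • β) i + d i).choose ((α + p • β) i) := fun hdiv =>
        hC (dvd_trans hdiv (Finset.dvd_prod_of_mem (fun s => ((α + p • β) s + d s).choose ((α + p • β) s))
          (Finset.mem_univ i)))
      have hmi : (α + p • β) i + d i = a' i + p * b' i + p ^ e * c i := by
        have := DFunLike.congr_fun hd i
        simp only [Finsupp.add_apply, Finsupp.smul_apply, smul_eq_mul] at this ⊢
        omega
      have hθi : (α + p • β) i = α i + p * β i := by
        simp only [Finsupp.add_apply, Finsupp.smul_apply, smul_eq_mul]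
      rw [hmi, hθi] at hndvd
      exact Nat.le_and_le_of_not_dvd_choose he (ha i) (hα i) (hb i) (hβ i) hndvd
    exact ⟨fun i => (hi i).1, fun i => (hi i).2⟩
  · exact absurd (hasseDeriv_monomial_of_not_le' hle coef) h

end Lucas

end Literature.RingTheory.MvPowerSeries

end
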